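import Summits.AtomisticToContinuum.HydrodynamicLimit.Theses.HeatBathForgetting
import Summits.AtomisticToContinuum.HydrodynamicLimit.Theorems.TwoClocksEntropyToHydro

/-!
# Route HeatBathForgetting — the `Assembly` item (stmt-AtomisticToContinuum-9455)

`Assembly` of route HeatBathForgetting is the entropy-inequality dock of Yau's relative entropy
method, `RelEntropyVanishing → Literature.MathematicalPhysics.KineticTheory.HydrodynamicLimit`
(the content of the shared glue item stmt-AtomisticToContinuum-0769, `EntropyToHydro`): if for
every `t < T` the law at time `t` has `o(N)` relative entropy with respect to a reference local
Gibbs law whose empirical fields concentrate exponentially around the Euler fields, then the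
empirical fields converge in probability at time `t` (entropy inequality for events,
`μ(A)·L ≤ KL(μ‖ν) + (e^L − 1)·ν(A)`, with `L = (N+1)/(2C)`).

The mathematics is already in the tree, unconditionally:
`Summit.AtomisticToContinuum.HydrodynamicLimit.Theorems.hydrodynamicLimit_of_relEntropyVanishing`
(`Theorems/TwoClocksEntropyToHydro.lean`), whose hypothesis is this route's `RelEntropyVanishing`
verbatim (the shared typed target stmt-AtomisticToContinuum-0766) and whose conclusion is the
sub-problem statement `HydrodynamicLimit`. This file instantiates it for route HeatBathForgetting's
declaration, which is the fifth hypothesis of the route's deciding theorem `closes`.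
-/

namespace Summit.AtomisticToContinuum.HydrodynamicLimit.Theorems

/-- The `Assembly` item of route HeatBathForgetting (stmt-AtomisticToContinuum-9455):
`RelEntropyVanishing → HydrodynamicLimit`, by `hydrodynamicLimit_of_relEntropyVanishing`
(entropy inequality for events + exponential concentration of the reference local Gibbs law +
transfer along the measurable flow, `λ_N{z | Φ_N.flow t z ∈ A} ≤ ((Φ_N.flow t)_* λ_N)(A)`), whose
hypothesis is the route's `RelEntropyVanishing` verbatim. [cite: Yau1991, §2]
[cite: KipnisLandim1999, Ch. 6 §1] -/
theorem heatBathForgetting_assembly_proof :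
    Summit.AtomisticToContinuum.HydrodynamicLimit.Theses.HeatBathForgetting.Assembly := by
  unfold Summit.AtomisticToContinuum.HydrodynamicLimit.Theses.HeatBathForgetting.Assembly
  intro hRE
  exact hydrodynamicLimit_of_relEntropyVanishing hRE

end Summit.AtomisticToContinuum.HydrodynamicLimit.Theorems
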